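import Summits.QuantumFields.BalabanUV.Beta.GAN24.SavgInverseUniform
import Summits.QuantumFields.BalabanUV.Beta.GAN24.ScalarZerothLetterTorus

/-!
# G-an2-4 ∕ (CONV-C) — THE UNIT-LATTICE INVERSE BEHIND THE GAUGE TERM `∂·P·∂ᴴ`: `Kcomp⁻¹ = (Q̃′G′G′Q̃′ᴴ)⁻¹` HAS UNIFORMLY
# BOUNDED, EXPONENTIALLY LOCALISED ENTRIES — every `n = η⁻¹ ≥ 1`, EVERY torus, every `a′ > 0`

G-an2-4 formalisation swarm `b2b-balaban-gan24-formalise-*`, leaf prover 01 (gen 56), crux team (2) under the coordinator ruling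
«YM REDIRECT» (e34b3e0c).  INTENT «DPD-LIT» (journal l.30179), FILE A of two: the literal [B5] (1.126)-shape entry decay of the
cell's typed gauge term `GradOp·PcT·GradOpᴴ` (`B5Value126.PcT`) factorises, by the substrate's
`ScalarGaugeProjectionUnit.GradOp_Pone_GradOpH_eq` ∕ `CTGaugeTerm.gaugeTerm_eq_factor`, as `X·Kcomp⁻¹·Xᴴ` with `X = ∂G′Q̃′ᴴ` and
NE2's compressed unit-lattice operator `Kcomp n M a′ = n^d·(Q′G′G′Q′ᴴ)` (`T4Continuum/Support/ScalarAveragedCompression`;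
`G′ = Gps n M a′ = (Δ + a′Π′)⁻¹`, `Q′ = QsOp n M` the block average (1.20)).  THIS FILE supplies the one new estimate on the
COARSE torus: the inverse `Kcomp⁻¹` has entries `≤ σ·e^{−δ|y − y′|_{T₁}}` with `σ, δ` depending on `(d, a′)` only.

ROAD ([folklore] finite-dimensional linear algebra over TREE theorems BY NAME — the (U-SINV) road of
`GAN24/SavgInverseUniform` (gan24-formalise-leaf-03, gen 49) re-run with `Savg ↦ Kcomp`):
 * §1 the two factor kernels `G′Q′ᴴ` and `Q′G′` have entries `≤ C·n^{−d}·e^{−δ₀|blk x − y|}` — the (L0) letter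
   `ScalarZerothLetterTorus.rowDecay_Gps` (= `ScalarSup110G.gps_block_row_sum_le`, EVERY torus) read entrywise through the block
   indicator `QsOp_apply_blockOf`, and `G′` Hermitian;
 * §2 hence `‖Kcomp(y, y′)‖ ≤ C²·K_{d+1}(δ₀∕2)·e^{−(δ₀∕2)|y − y′|}` (`sum_blocks`: the `n^d` fine points of a block against the two
   factors `n^{−d}` and the prefactor `n^d`; one torus convolution `EffectiveKernel.sum_exp_ldist_le`);
 * §3 Combes–Thomas on the unit torus: `Kcomp` is Hermitian (`Kcomp_isHermitian`) and `σ₀(d,a′)²`-coercive UNIFORMLY in `n`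
   (`ScalarAveragedCompression.form_Kcomp_ge`); the small-rate cosh budget `SavgInverseUniform.ctRowDefect_le_of_decay_small` +
   `AccretiveCombesThomasBudget.conjLower_of_isHermitian` + `AccretiveCombesThomas.conjCoercive_of_conjLower ∕ norm_inv_apply_le`
   give `‖Kcomp⁻¹(y, y′)‖ ≤ (2∕σ₀²)·e^{−δ_K|y − y′|}` at the rate `δ_K = min(δ₀∕8, σ₀²δ₀∕(8·θ·L))`, `θ = C²·K_{d+1}(δ₀∕2) + 1`,
   `L = K_{d+1}(δ₀∕8)` (`K = B4Sect5Proof.latticeConst`, volume-free);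
 * §4 ENDs in the road-P2 currencies: **`kcomp_inv_decay`** (`∃ σ δ > 0, ∀ n M y y′, ‖(Kcomp n M a′)⁻¹ y y′‖ ≤
   σ·exp(−δ·torusSupNorm M (rep M y − rep M y′))`), the `RowDecay M id id` form and the sup → sup form `kcomp_inv_sup`.

HONEST SCOPE.  `U = 1`; EVERY torus `M : Fin (d+1) → ℕ`, every `n ≥ 1`, every `a′ > 0`; constants existential in `(d, a′)` (they
inherit (L0)'s).  OUR estimate, [folklore]-grade; nothing printed is asserted — [B5] `Balaban1984PropagatorsI` p. 38 (1.126) and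
its sentence «from the representation P = G′Q′*(Q′G′²Q′*)⁻¹Q′G′, from Lemma 2.4 of [2]» are TEXT LOCATIONS (pv15's
`B5DPD126Uniform` certifies the multiplier MODEL; this file is about the literal typed operators).  No `def … : Prop`, no `sorry`.
Discharges no binder of (CONV-C) as typed; NOT (CONV-C), NEVER «G-an2-4 closed», NOT NE2 ∕ NE3, NOT D1, NOT BetaPertH, NOT continuum,
NOT Clay; not in print — our bookkeeping.  ABSOLUTE RULE of the cell kept.
HONEST DEPENDENCY: continuum YM on T⁴ ⇐ BetaPertH ∧ nine spine estimates (0/9 proved); BetaPertH ⇐ (D1) ∧ (D4) ∧ CAP+tail; G-an2-4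
gates asym, D1 and NE2/3/4.
-/

noncomputable section

open scoped BigOperators ComplexConjugate Matrix ComplexOrder
open Finset

namespace Summit.QuantumFields.BalabanUV.Beta.GAN24.KcompInverseUniform

open Literature.MathematicalPhysics.QuantumFieldTheory.Balaban1983to89
open B5Prop11Plancherel (Tor fine)
open B5Prop11Lower (nsq nsq_nonneg)
open B5Block118 (bpt QsOp)
open B5Blocks16 (blockOf blockOf_bpt sum_blocks)
open B4TorusKernel.MultiPeriod (torusSupNorm torusSupNorm_nonneg)
open B4Sect5Proof (latticeConst latticeConst_nonneg)
open B6LowerBound2153Torus (rep)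
open Beta.TorusG0Decay (ldist ldist_self ldist_symm ldist_triangle)
open Beta.EffectiveKernel (sum_exp_ldist_le)
open Beta.DeltaACombesThomas (ctRowDefect)
open Summit.QuantumFields.BalabanUV.T4Continuum
open Summit.QuantumFields.BalabanUV.T4Continuum.ScalarBlockPoincare (QsOp_apply_blockOf)
open Summit.QuantumFields.BalabanUV.T4Continuum.ScalarAveragedPropagator (Gps Gps_isHermitian)
open Summit.QuantumFields.BalabanUV.T4Continuum.ScalarAveragedCompression (Kcomp Kcomp_isHermitian sigma0 sigma0_pos
  form_Kcomp_ge)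
open Summit.QuantumFields.BalabanUV.Beta.AccretiveCombesThomas (conjForm norm_inv_apply_le conjCoercive_of_conjLower conjLower_mono)
open Summit.QuantumFields.BalabanUV.Beta.AccretiveCombesThomasBudget (conjLower_of_isHermitian)
open Summit.QuantumFields.BalabanUV.Beta.GAN24.BlockFieldDecay (RowDecay)
open Summit.QuantumFields.BalabanUV.Beta.GAN24.ScalarZerothLetterTorus (rowDecay_Gps)
open Summit.QuantumFields.BalabanUV.Beta.GAN24.SavgInverseUniform (ctRowDefect_le_of_decay_small ldist_nonneg
  abs_ldist_sub_ldist_le ldist_eq_torusSupNorm latticeConst_pos_of_pos)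

variable {d : ℕ}

/-! ## §1 The factor kernels `G′Q′ᴴ` and `Q′G′` from the (L0) letter -/

section Factors

variable (n : ℕ) [NeZero n] (M : Fin (d + 1) → ℕ) [hM : ∀ μ, NeZero (M μ)] {a' C δ : ℝ}

/-- the entry `(G′Q′ᴴ)(x, y) = n^{−(d+1)}·Σ_{x′ ∈ B(y)} G′(x, x′)`. [folklore] -/
theorem Gps_mul_QsOpH_apply (a' : ℝ) (x : Tor (fine n M)) (y : Tor M) :
    (Gps n M a' * (QsOp n M)ᴴ) x y
      = (1 / (n : ℂ) ^ (d + 1)) * ∑ x', (if blockOf n M x' = y then Gps n M a' x x' else 0) := by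
  rw [Matrix.mul_apply, Finset.mul_sum]
  refine Finset.sum_congr rfl fun x' _ => ?_
  rw [Matrix.conjTranspose_apply, QsOp_apply_blockOf]
  split_ifs with h
  · rw [star_div₀, star_one, star_pow, Complex.star_def, Complex.conj_natCast]; ring
  · rw [star_zero, mul_zero, mul_zero]

/-- **`|(G′Q′ᴴ)(x, y)| ≤ C·n^{−(d+1)}·e^{−δ|blk x − y|}`** from the per-block row decay of `G′`. [folklore] -/
theorem norm_Gps_mul_QsOpH_apply_le (hrow : RowDecay M (blockOf n M) (blockOf n M) (Gps n M a') C δ)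
    (x : Tor (fine n M)) (y : Tor M) :
    ‖(Gps n M a' * (QsOp n M)ᴴ) x y‖ ≤ C / (n : ℝ) ^ (d + 1) * Real.exp (-(δ * ldist M (blockOf n M x) y)) := by
  have hn : (0 : ℝ) < (n : ℝ) ^ (d + 1) := pow_pos (Nat.cast_pos.mpr (NeZero.pos n)) _
  rw [Gps_mul_QsOpH_apply, norm_mul, norm_div, norm_one, norm_pow, Complex.norm_natCast, ldist_eq_torusSupNorm]
  have h1 : ‖∑ x', (if blockOf n M x' = y then Gps n M a' x x' else 0)‖
      ≤ ∑ x', (if blockOf n M x' = y then ‖Gps n M a' x x'‖ else 0) := by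
    refine (norm_sum_le _ _).trans (Finset.sum_le_sum fun x' _ => ?_)
    split_ifs <;> simp
  have h2 := hrow x y
  calc 1 / (n : ℝ) ^ (d + 1) * ‖∑ x', (if blockOf n M x' = y then Gps n M a' x x' else 0)‖
      ≤ 1 / (n : ℝ) ^ (d + 1) * (C * Real.exp (-(δ * torusSupNorm M (rep M (blockOf n M x) - rep M y)))) :=
        mul_le_mul_of_nonneg_left (h1.trans h2) (by positivity)
    _ = C / (n : ℝ) ^ (d + 1) * Real.exp (-(δ * torusSupNorm M (rep M (blockOf n M x) - rep M y))) := by ring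

/-- `(Q′G′)(y, x) = conj((G′Q′ᴴ)(x, y))` (`G′` Hermitian). [folklore] -/
theorem QsOp_mul_Gps_apply (a' : ℝ) (y : Tor M) (x : Tor (fine n M)) :
    (QsOp n M * Gps n M a') y x = star ((Gps n M a' * (QsOp n M)ᴴ) x y) := by
  have h : QsOp n M * Gps n M a' = (Gps n M a' * (QsOp n M)ᴴ)ᴴ := by
    rw [Matrix.conjTranspose_mul, Matrix.conjTranspose_conjTranspose, (Gps_isHermitian n M a').eq]
  rw [h, Matrix.conjTranspose_apply]

/-- **`|(Q′G′)(y, x)| ≤ C·n^{−(d+1)}·e^{−δ|blk x − y|}`**. [folklore] -/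
theorem norm_QsOp_mul_Gps_apply_le (hrow : RowDecay M (blockOf n M) (blockOf n M) (Gps n M a') C δ)
    (y : Tor M) (x : Tor (fine n M)) :
    ‖(QsOp n M * Gps n M a') y x‖ ≤ C / (n : ℝ) ^ (d + 1) * Real.exp (-(δ * ldist M (blockOf n M x) y)) := by
  rw [QsOp_mul_Gps_apply, norm_star]
  exact norm_Gps_mul_QsOpH_apply_le n M hrow x y

end Factors

/-! ## §2 The entries of `Kcomp = n^{d+1}·Q′G′G′Q′ᴴ` decay, uniformly in `n` and in the torus -/

section Entries

variable (n : ℕ) [NeZero n] (M : Fin (d + 1) → ℕ) [hM : ∀ μ, NeZero (M μ)] {a' C δ : ℝ}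

/-- `Kcomp(y, y′) = n^{d+1}·Σ_x (Q′G′)(y, x)·(G′Q′ᴴ)(x, y′)`. [folklore] -/
theorem Kcomp_apply (a' : ℝ) (y y' : Tor M) :
    Kcomp n M a' y y' = (n : ℂ) ^ (d + 1) * ∑ x, (QsOp n M * Gps n M a') y x * (Gps n M a' * (QsOp n M)ᴴ) x y' := by
  rw [Kcomp, Matrix.smul_apply, smul_eq_mul, Matrix.mul_assoc (QsOp n M * Gps n M a'), Matrix.mul_apply]

/-- the elementary splitting `e^{−δ(a+b)} ≤ e^{−(δ/2)c}·e^{−(δ/2)a}` when `c ≤ a + b`, `0 ≤ b`, `0 ≤ δ`. [folklore] -/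
theorem exp_split {δ a b c : ℝ} (hδ : 0 ≤ δ) (hb : 0 ≤ b) (hc : c ≤ a + b) :
    Real.exp (-(δ * a)) * Real.exp (-(δ * b)) ≤ Real.exp (-(δ / 2 * c)) * Real.exp (-(δ / 2 * a)) := by
  rw [← Real.exp_add, ← Real.exp_add]
  refine Real.exp_le_exp.mpr ?_
  nlinarith [mul_nonneg hδ hb, mul_le_mul_of_nonneg_left hc hδ]

/-- **ENTRY DECAY OF `Kcomp`**: `‖Kcomp(y, y′)‖ ≤ C²·K_{d+1}(δ∕2)·e^{−(δ∕2)|y − y′|_{T₁}}` from the per-block row decay of `G′`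
with constants `(C, δ)`. [folklore] -/
theorem norm_Kcomp_apply_le_of_rowDecay (hC : 0 ≤ C) (hδ : 0 < δ)
    (hrow : RowDecay M (blockOf n M) (blockOf n M) (Gps n M a') C δ) (y y' : Tor M) :
    ‖Kcomp n M a' y y'‖ ≤ C ^ 2 * latticeConst (d + 1) (δ / 2) * Real.exp (-(δ / 2 * ldist M y y')) := by
  have hn0 : (0 : ℝ) < (n : ℝ) := Nat.cast_pos.mpr (NeZero.pos n)
  have hn : (0 : ℝ) < (n : ℝ) ^ (d + 1) := pow_pos hn0 _
  -- the summand bound, block by block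
  have hterm : ∀ x : Tor (fine n M),
      ‖(QsOp n M * Gps n M a') y x * (Gps n M a' * (QsOp n M)ᴴ) x y'‖
        ≤ (C / (n : ℝ) ^ (d + 1)) ^ 2 * (Real.exp (-(δ * ldist M (blockOf n M x) y))
            * Real.exp (-(δ * ldist M (blockOf n M x) y'))) := by
    intro x
    rw [norm_mul]
    have h1 := norm_QsOp_mul_Gps_apply_le n M hrow y x
    have h2 := norm_Gps_mul_QsOpH_apply_le n M hrow x y'
    calc ‖(QsOp n M * Gps n M a') y x‖ * ‖(Gps n M a' * (QsOp n M)ᴴ) x y'‖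
        ≤ (C / (n : ℝ) ^ (d + 1) * Real.exp (-(δ * ldist M (blockOf n M x) y)))
            * (C / (n : ℝ) ^ (d + 1) * Real.exp (-(δ * ldist M (blockOf n M x) y'))) :=
          mul_le_mul h1 h2 (norm_nonneg _) (by positivity)
      _ = _ := by ring
  -- split the exponentials around `y`
  have hsplit : ∀ z : Tor M, Real.exp (-(δ * ldist M z y)) * Real.exp (-(δ * ldist M z y'))
      ≤ Real.exp (-(δ / 2 * ldist M y y')) * Real.exp (-(δ / 2 * ldist M y z)) := by
    intro z
    have htri : ldist M y y' ≤ ldist M z y + ldist M z y' := by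
      have := ldist_triangle M y z y'; rw [ldist_symm M y z] at this; exact this
    have h := exp_split hδ.le (ldist_nonneg M z y') htri
    rwa [ldist_symm M y z]
  -- sum over the fine torus block by block
  have hsum : ∑ x : Tor (fine n M), ‖(QsOp n M * Gps n M a') y x * (Gps n M a' * (QsOp n M)ᴴ) x y'‖
      ≤ (C / (n : ℝ) ^ (d + 1)) ^ 2 * ((n : ℝ) ^ (d + 1) * (Real.exp (-(δ / 2 * ldist M y y'))
          * latticeConst (d + 1) (δ / 2))) := by
    have e : ∑ x : Tor (fine n M), ‖(QsOp n M * Gps n M a') y x * (Gps n M a' * (QsOp n M)ᴴ) x y'‖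
        = ∑ z : Tor M, ∑ j : Fin (d + 1) → Fin n,
            ‖(QsOp n M * Gps n M a') y (bpt n M z j) * (Gps n M a' * (QsOp n M)ᴴ) (bpt n M z j) y'‖ := by
      have := sum_blocks n M (fun x => (‖(QsOp n M * Gps n M a') y x * (Gps n M a' * (QsOp n M)ᴴ) x y'‖ : ℂ))
      exact_mod_cast this
    rw [e]
    calc ∑ z : Tor M, ∑ j : Fin (d + 1) → Fin n,
          ‖(QsOp n M * Gps n M a') y (bpt n M z j) * (Gps n M a' * (QsOp n M)ᴴ) (bpt n M z j) y'‖
        ≤ ∑ z : Tor M, ∑ _j : Fin (d + 1) → Fin n, (C / (n : ℝ) ^ (d + 1)) ^ 2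
            * (Real.exp (-(δ / 2 * ldist M y y')) * Real.exp (-(δ / 2 * ldist M y z))) := by
          refine Finset.sum_le_sum fun z _ => Finset.sum_le_sum fun j _ => ?_
          refine (hterm _).trans ?_
          rw [blockOf_bpt]
          exact mul_le_mul_of_nonneg_left (hsplit z) (by positivity)
      _ = (C / (n : ℝ) ^ (d + 1)) ^ 2 * ((n : ℝ) ^ (d + 1) * (Real.exp (-(δ / 2 * ldist M y y'))
            * ∑ z : Tor M, Real.exp (-(δ / 2 * ldist M y z)))) := by
          simp only [Finset.sum_const, Finset.card_univ, Finset.mul_sum]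
          rw [Fintype.card_pi, Finset.prod_const, Fintype.card_fin, Finset.card_univ, Fintype.card_fin]
          ring
      _ ≤ (C / (n : ℝ) ^ (d + 1)) ^ 2 * ((n : ℝ) ^ (d + 1) * (Real.exp (-(δ / 2 * ldist M y y'))
            * latticeConst (d + 1) (δ / 2))) := by
          have hL := sum_exp_ldist_le M y (half_pos hδ)
          gcongr
  rw [Kcomp_apply, norm_mul, norm_pow, Complex.norm_natCast]
  calc (n : ℝ) ^ (d + 1) * ‖∑ x, (QsOp n M * Gps n M a') y x * (Gps n M a' * (QsOp n M)ᴴ) x y'‖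
      ≤ (n : ℝ) ^ (d + 1) * ∑ x, ‖(QsOp n M * Gps n M a') y x * (Gps n M a' * (QsOp n M)ᴴ) x y'‖ :=
        mul_le_mul_of_nonneg_left (norm_sum_le _ _) hn.le
    _ ≤ (n : ℝ) ^ (d + 1) * ((C / (n : ℝ) ^ (d + 1)) ^ 2 * ((n : ℝ) ^ (d + 1)
          * (Real.exp (-(δ / 2 * ldist M y y')) * latticeConst (d + 1) (δ / 2)))) :=
        mul_le_mul_of_nonneg_left hsum hn.le
    _ = C ^ 2 * latticeConst (d + 1) (δ / 2) * Real.exp (-(δ / 2 * ldist M y y')) := by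
        field_simp

end Entries

/-! ## §3 Combes–Thomas on the unit torus: the inverse is exponentially localised -/

section Inverse

variable (n : ℕ) [NeZero n] (M : Fin (d + 1) → ℕ) [hM : ∀ μ, NeZero (M μ)] {a' θ κ₀ : ℝ}

/-- **conjugated coercivity of `Kcomp`** along every distance weight, at the small rate
`δ_K ≤ min(κ₀∕4, σ₀²κ₀∕(8θL))`, `L = K_{d+1}(κ₀∕4)`, with constant `σ₀²∕2` — from the entry decay `‖Kcomp(e,e′)‖ ≤ θe^{−κ₀|e−e′|}`,
the uniform coercivity `form_Kcomp_ge` and the small-rate cosh budget. [folklore] -/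
theorem conjCoercive_Kcomp (ha' : 0 < a') (hθ : 0 < θ) (hκ₀ : 0 < κ₀)
    (hH : ∀ e e' : Tor M, ‖Kcomp n M a' e e'‖ ≤ θ * Real.exp (-(κ₀ * ldist M e e')))
    {δK : ℝ} (hδK0 : 0 ≤ δK) (hδK1 : δK ≤ κ₀ / 4)
    (hδK2 : 2 * θ * latticeConst (d + 1) (κ₀ / 4) / κ₀ * δK ≤ (sigma0 (d + 1) a') ^ 2 / 2)
    (y' : Tor M) (z : Tor M → ℂ) :
    (sigma0 (d + 1) a') ^ 2 / 2 * nsq z ≤ (conjForm (Kcomp n M a') δK (fun e => ldist M e y') z).re := by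
  have hdef : ∀ e, ctRowDefect (Kcomp n M a') δK (fun e => ldist M e y') e
      ≤ 2 * θ * latticeConst (d + 1) (κ₀ / 4) / κ₀ * δK := fun e =>
    ctRowDefect_le_of_decay_small (Kcomp n M a') hδK0 hκ₀ hδK1 hθ.le (fun e => ldist M e y') (ldist M)
      (ldist_nonneg M) (abs_ldist_sub_ldist_le M y') hH (fun e => sum_exp_ldist_le M e (by positivity)) e
  have hlow := conjLower_of_isHermitian (Kcomp n M a') (Kcomp_isHermitian n M) δK (fun e => ldist M e y') hdef
  have hlow' := conjLower_mono hlow hδK2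
  have h := conjCoercive_of_conjLower (fun z => form_Kcomp_ge n M ha' z) hlow' z
  linarith

/-- **THE KERNEL OF `Kcomp⁻¹` IS UNIFORMLY BOUNDED AND EXPONENTIALLY LOCALISED** (given the entry decay of `Kcomp` with constants
`(θ, κ₀)`): `‖Kcomp⁻¹(y, y′)‖ ≤ (2∕σ₀²)·e^{−δ_K|y − y′|_{T₁}}`. [folklore] -/
theorem norm_Kcomp_inv_apply_le_of_decay (ha' : 0 < a') (hθ : 0 < θ) (hκ₀ : 0 < κ₀)
    (hH : ∀ e e' : Tor M, ‖Kcomp n M a' e e'‖ ≤ θ * Real.exp (-(κ₀ * ldist M e e')))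
    {δK : ℝ} (hδK0 : 0 ≤ δK) (hδK1 : δK ≤ κ₀ / 4)
    (hδK2 : 2 * θ * latticeConst (d + 1) (κ₀ / 4) / κ₀ * δK ≤ (sigma0 (d + 1) a') ^ 2 / 2) (y y' : Tor M) :
    ‖(Kcomp n M a')⁻¹ y y'‖ ≤ 2 / (sigma0 (d + 1) a') ^ 2 * Real.exp (-(δK * ldist M y y')) := by
  have hσ : 0 < (sigma0 (d + 1) a') ^ 2 / 2 := by have := sigma0_pos (d := d + 1) ha'; positivity
  have h := norm_inv_apply_le (Kcomp n M a') (ldist M) (ldist_self M) hδK0 hσ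
    (fun j z => conjCoercive_Kcomp n M ha' hθ hκ₀ hH hδK0 hδK1 hδK2 j z) y y'
  calc ‖(Kcomp n M a')⁻¹ y y'‖ ≤ Real.exp (-(δK * ldist M y y')) / ((sigma0 (d + 1) a') ^ 2 / 2) := h
    _ = 2 / (sigma0 (d + 1) a') ^ 2 * Real.exp (-(δK * ldist M y y')) := by
        field_simp

end Inverse

/-! ## §4 ENDs: the constants chosen BEFORE `n` and the torus; road P2's currencies -/

section End

variable (d)

/-- **END — `Kcomp⁻¹` IS UNIFORMLY LOCALISED, EVERY TORUS**: for every `a′ > 0` there are `σ, δ > 0` (depending on `(d, a′)` only)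
with `‖(Kcomp n M a′)⁻¹ y y′‖ ≤ σ·e^{−δ·|rep y − rep y′|_{T,∞}}` for every `n ≥ 1`, every torus `M : Fin (d+1) → ℕ`, all `y, y′`.
Inputs BY NAME: `rowDecay_Gps` (= (L0)), `form_Kcomp_ge`, `Kcomp_isHermitian`, the Combes–Thomas engine.  OUR estimate; [B5] p. 38
(1.126) is a text location. [folklore] -/
theorem kcomp_inv_decay {a' : ℝ} (ha' : 0 < a') :
    ∃ σ δ : ℝ, 0 < σ ∧ 0 < δ ∧ ∀ (n : ℕ) [NeZero n] (M : Fin (d + 1) → ℕ) [∀ μ, NeZero (M μ)] (y y' : Tor M),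
      ‖(Kcomp n M a')⁻¹ y y'‖ ≤ σ * Real.exp (-(δ * torusSupNorm M (rep M y - rep M y'))) := by
  obtain ⟨δ₀, C, hδ₀, hC, hrow⟩ := rowDecay_Gps d ha'
  -- the entry-decay constants of `Kcomp`
  set θ : ℝ := C ^ 2 * latticeConst (d + 1) (δ₀ / 2) + 1 with hθdef
  set κ₀ : ℝ := δ₀ / 2 with hκ₀def
  have hL1 : 0 < latticeConst (d + 1) (δ₀ / 2) := latticeConst_pos_of_pos (Nat.succ_pos d) (half_pos hδ₀)
  have hθ : 0 < θ := by positivity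
  have hκ₀ : 0 < κ₀ := half_pos hδ₀
  set L : ℝ := latticeConst (d + 1) (κ₀ / 4) with hLdef
  have hL : 0 < L := latticeConst_pos_of_pos (Nat.succ_pos d) (by positivity)
  set γ : ℝ := (sigma0 (d + 1) a') ^ 2 with hγdef
  have hγ : 0 < γ := by have := sigma0_pos (d := d + 1) ha'; positivity
  -- the conjugation rate
  set δK : ℝ := min (κ₀ / 4) (γ * κ₀ / (4 * θ * L)) with hδKdef
  have hδK : 0 < δK := lt_min (by positivity) (by positivity)
  have hδK1 : δK ≤ κ₀ / 4 := min_le_left _ _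
  have hδK2 : 2 * θ * L / κ₀ * δK ≤ γ / 2 := by
    have h2 : δK ≤ γ * κ₀ / (4 * θ * L) := min_le_right _ _
    calc 2 * θ * L / κ₀ * δK ≤ 2 * θ * L / κ₀ * (γ * κ₀ / (4 * θ * L)) :=
          mul_le_mul_of_nonneg_left h2 (by positivity)
      _ = γ / 2 := by field_simp; ring
  refine ⟨2 / γ, δK, by positivity, hδK, ?_⟩
  intro n _ M _ y y'
  have hH : ∀ e e' : Tor M, ‖Kcomp n M a' e e'‖ ≤ θ * Real.exp (-(κ₀ * ldist M e e')) := by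
    intro e e'
    refine (norm_Kcomp_apply_le_of_rowDecay n M hC.le hδ₀ (hrow n M) e e').trans ?_
    exact mul_le_mul_of_nonneg_right (by linarith) (Real.exp_pos _).le
  have h := norm_Kcomp_inv_apply_le_of_decay n M ha' hθ hκ₀ hH hδK.le hδK1 hδK2 y y'
  rwa [ldist_eq_torusSupNorm] at h

/-- **the same in road P2's `RowDecay` currency** (`βₒ = βᵢ = id` on the unit torus): a single entry per column block. [folklore] -/
theorem kcomp_inv_rowDecay {a' : ℝ} (ha' : 0 < a') :
    ∃ σ δ : ℝ, 0 < σ ∧ 0 < δ ∧ ∀ (n : ℕ) [NeZero n] (M : Fin (d + 1) → ℕ) [∀ μ, NeZero (M μ)],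
      RowDecay M id id (Kcomp n M a')⁻¹ σ δ := by
  obtain ⟨σ, δ, hσ, hδ, h⟩ := kcomp_inv_decay d ha'
  refine ⟨σ, δ, hσ, hδ, fun n _ M _ x y' => ?_⟩
  rw [Finset.sum_eq_single y' (fun b _ hb => if_neg (fun hb' : id b = y' => hb hb'))
    (fun hy => absurd (Finset.mem_univ _) hy), if_pos (show id y' = y' from rfl)]
  exact h n M x y'

/-- **the sup → sup form**: `‖(Kcomp⁻¹v)(y)‖ ≤ σ·K_{d+1}(δ)·‖v‖_∞`, every `n`, every torus. [folklore] -/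
theorem kcomp_inv_sup {a' : ℝ} (ha' : 0 < a') :
    ∃ S : ℝ, 0 < S ∧ ∀ (n : ℕ) [NeZero n] (M : Fin (d + 1) → ℕ) [∀ μ, NeZero (M μ)] (v : Tor M → ℂ) (b : ℝ),
      (∀ y, ‖v y‖ ≤ b) → ∀ y, ‖((Kcomp n M a')⁻¹ *ᵥ v) y‖ ≤ S * b := by
  obtain ⟨σ, δ, hσ, hδ, h⟩ := kcomp_inv_decay d ha'
  refine ⟨σ * latticeConst (d + 1) δ, mul_pos hσ (latticeConst_pos_of_pos (Nat.succ_pos d) hδ), ?_⟩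
  intro n _ M _ v b hv y
  have hb : 0 ≤ b := (norm_nonneg _).trans (hv y)
  rw [Matrix.mulVec, dotProduct]
  calc ‖∑ y', (Kcomp n M a')⁻¹ y y' * v y'‖ ≤ ∑ y', ‖(Kcomp n M a')⁻¹ y y'‖ * ‖v y'‖ := by
        refine (norm_sum_le _ _).trans (Finset.sum_le_sum fun y' _ => ?_); rw [norm_mul]
    _ ≤ ∑ y', σ * Real.exp (-(δ * torusSupNorm M (rep M y - rep M y'))) * b :=
        Finset.sum_le_sum fun y' _ => mul_le_mul (h n M y y') (hv y') (norm_nonneg _) (by positivity)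
    _ = σ * b * ∑ y', Real.exp (-(δ * ldist M y y')) := by
        rw [Finset.mul_sum]
        refine Finset.sum_congr rfl fun y' _ => ?_
        rw [ldist_eq_torusSupNorm]; ring
    _ ≤ σ * b * latticeConst (d + 1) δ := mul_le_mul_of_nonneg_left (sum_exp_ldist_le M y hδ) (by positivity)
    _ = σ * latticeConst (d + 1) δ * b := by ring

end End

end Summit.QuantumFields.BalabanUV.Beta.GAN24.KcompInverseUniform

end
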